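import Mathlib
import Literature.Computability.AlgebraicComplexity.GroupAlgebraTensor
import Literature.Computability.AlgebraicComplexity.MignonRessayreBound
import Summits.MatrixMultiplication.MatrixMultiplication.Theses.ProbeRankScaling

/-!
# MatrixMultiplication / ProbeRankScaling — toolkit for `PanTwoFold`
(stmt-MatrixMultiplication-7539)

Helper lemmas for the block-paired two-fold aggregation algorithm
(`ProbeRankScalingPanTwoFold.lean`, theorem `panTwoFold_proof`):

* a 3-tensor over finite index sets is determined by its trilinear form
  `(z, x, y) ↦ ∑ t_{abc} z_a x_b y_c` (`tensor_eq_of_forall_trilinear_eq`); the trilinear form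
  of a sum of triads is `∑_l ⟨w_l,z⟩⟨u_l,x⟩⟨v_l,y⟩` (`trilinear_sum_triad`) and that of the
  matrix multiplication tensor on an index type `α` is the trace form
  `∑ z_{κν} x_{κμ} y_{μν}` (`trilinear_matMulTensorOn`);
* legs ("probes") of the form `q ↦ (vecMulVec a b + vecMulVec c d) q.1 q.2` have matrix rank
  `≤ 2` (`rank_leg_two_le`, from
  `Literature.Computability.AlgebraicComplexity.rank_vecMulVec_add_vecMulVec_le`) and their
  linear forms are computed by `sum_leg_two_mul`, `sum_single_mul_single_mul` (an entry),
  `sum_single_mul_block_mul` / `sum_block_mul_single_mul` (row / column segments of a block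
  of `Fin 2 × ι`);
* Pan's two-fold aggregation identity `pan_pair_identity` (Pan 1984, (4.1)–(4.3) with
  `m = n = p`), a polynomial identity with symbolic sums over a finite type, true monomial by
  monomial;
* the term index set `Fin 2 × Fin 2 × (ι³ ⊕ ι² ⊕ ι² ⊕ ι²)`: unrolled summation and
  cardinality `4 (s³ + 3 s²)` (`sum_pan_index`, `card_pan_index`).

No definitions are introduced (pure proof file).

References: V. Ya. Pan, *How can we speed up matrix multiplication?*, SIAM Review 26 (1984),
§4, (4.1)–(4.3); M. Bläser, *Fast Matrix Multiplication*, Theory of Computing Graduate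
Surveys 5 (2013), §§4–5.
-/

set_option linter.dupNamespace false

noncomputable section

open scoped BigOperators
open Matrix

namespace Summit.MatrixMultiplication.MatrixMultiplication.Theorems

open Literature.Computability.AlgebraicComplexity

/-! ## Trilinear forms determine tensors -/

section Trilinear

variable {A B C : Type*} [Fintype A] [Fintype B] [Fintype C] [DecidableEq A] [DecidableEq B]
  [DecidableEq C]

/-- A 3-tensor over finite index sets is determined by its trilinear form
`(z, x, y) ↦ ∑_{a,b,c} t_{abc} z_a x_b y_c` (evaluate at coordinate vectors). [folklore] -/
theorem tensor_eq_of_forall_trilinear_eq {t t' : A → B → C → ℂ}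
    (h : ∀ (z : A → ℂ) (x : B → ℂ) (y : C → ℂ),
      ∑ a, ∑ b, ∑ c, t a b c * (z a * x b * y c) =
        ∑ a, ∑ b, ∑ c, t' a b c * (z a * x b * y c)) :
    t = t' := by
  funext a₀ b₀ c₀
  have key : ∀ r : A → B → C → ℂ, ∑ a, ∑ b, ∑ c, r a b c *
      ((Pi.single a₀ (1 : ℂ) : A → ℂ) a * (Pi.single b₀ (1 : ℂ) : B → ℂ) b *
        (Pi.single c₀ (1 : ℂ) : C → ℂ) c) = r a₀ b₀ c₀ := by
    intro r
    rw [Finset.sum_eq_single a₀ (fun a _ ha => by simp [ha]) (by simp)]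
    rw [Finset.sum_eq_single b₀ (fun b _ hb => by simp [hb]) (by simp)]
    rw [Finset.sum_eq_single c₀ (fun c _ hc => by simp [hc]) (by simp)]
    simp
  rw [← key t, ← key t', h]

omit [DecidableEq A] [DecidableEq B] [DecidableEq C] in
/-- The trilinear form of a sum of triads `∑_l w_l ⊗ u_l ⊗ v_l` is
`∑_l ⟨w_l, z⟩ ⟨u_l, x⟩ ⟨v_l, y⟩`. [folklore] -/
theorem trilinear_sum_triad {σ : Type*} [Fintype σ] (w : σ → A → ℂ) (u : σ → B → ℂ)
    (v : σ → C → ℂ) (z : A → ℂ) (x : B → ℂ) (y : C → ℂ) :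
    ∑ a, ∑ b, ∑ c, (∑ l, triad (w l) (u l) (v l)) a b c * (z a * x b * y c) =
      ∑ l, (∑ a, w l a * z a) * (∑ b, u l b * x b) * (∑ c, v l c * y c) := by
  have hl : ∀ a b c, (∑ l, triad (w l) (u l) (v l)) a b c * (z a * x b * y c) =
      ∑ l, (w l a * z a) * ((u l b * x b) * (v l c * y c)) := by
    intro a b c
    rw [Finset.sum_apply, Finset.sum_apply, Finset.sum_apply, Finset.sum_mul]
    exact Finset.sum_congr rfl fun l _ => by rw [triad_apply]; ring
  have hr : ∀ l, (∑ a, w l a * z a) * (∑ b, u l b * x b) * (∑ c, v l c * y c) =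
      ∑ a, ∑ b, ∑ c, (w l a * z a) * ((u l b * x b) * (v l c * y c)) := by
    intro l
    rw [Finset.sum_mul_sum, Finset.sum_mul]
    refine Finset.sum_congr rfl fun a _ => ?_
    rw [Finset.sum_mul_sum]
    refine Finset.sum_congr rfl fun b _ => Finset.sum_congr rfl fun c _ => ?_
    ring
  simp_rw [hl, hr]
  have e1 : ∀ G : A → B → C → σ → ℂ, (∑ a, ∑ b, ∑ c, ∑ l, G a b c l) =
      ∑ t : A × B × C, ∑ l, G t.1 t.2.1 t.2.2 l := by
    intro G; simp only [Fintype.sum_prod_type]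
  have e2 : ∀ G : A → B → C → σ → ℂ, (∑ l, ∑ a, ∑ b, ∑ c, G a b c l) =
      ∑ l, ∑ t : A × B × C, G t.1 t.2.1 t.2.2 l := by
    intro G; simp only [Fintype.sum_prod_type]
  rw [e1 fun a b c l => (w l a * z a) * ((u l b * x b) * (v l c * y c)),
    e2 fun a b c l => (w l a * z a) * ((u l b * x b) * (v l c * y c))]
  exact Finset.sum_comm

/-- The trilinear form of the matrix multiplication tensor on an index type `α` is the trace
form `∑_{κ,μ,ν} z_{κν} x_{κμ} y_{μν}`. [folklore] -/
theorem trilinear_matMulTensorOn {α : Type*} [Fintype α] [DecidableEq α]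
    (z x y : α × α → ℂ) :
    ∑ a, ∑ b, ∑ c, matMulTensorOn ℂ α α α a b c * (z a * x b * y c) =
      ∑ κ, ∑ μ, ∑ ν, z (κ, ν) * x (κ, μ) * y (μ, ν) := by
  have hc : ∀ a b : α × α, ∑ c, matMulTensorOn ℂ α α α a b c * (z a * x b * y c) =
      if a.1 = b.1 then z a * x b * y (b.2, a.2) else 0 := by
    intro a b
    rw [Finset.sum_eq_single (b.2, a.2)]
    · by_cases h : a.1 = b.1 <;> simp [matMulTensorOn_apply, h]
    · rintro c - hc'
      have hne : ¬ (a.1 = b.1 ∧ b.2 = c.1 ∧ a.2 = c.2) := by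
        rintro ⟨-, h2, h3⟩
        exact hc' (Prod.ext h2.symm h3.symm)
      simp [matMulTensorOn_apply, hne]
    · simp
  have hb : ∀ a : α × α, ∑ b : α × α, (if a.1 = b.1 then z a * x b * y (b.2, a.2) else 0) =
      ∑ μ, z a * x (a.1, μ) * y (μ, a.2) := by
    intro a
    rw [Fintype.sum_prod_type, Finset.sum_comm]
    simp only [Finset.sum_ite_eq, Finset.mem_univ, if_true]
  simp_rw [hc, hb]
  rw [Fintype.sum_prod_type]
  exact Finset.sum_congr rfl fun κ _ => Finset.sum_comm

end Trilinear

/-! ## Legs of the form `a bᵀ + c dᵀ`: rank and linear forms -/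

section Legs

variable {α ι : Type*} [Fintype α] [DecidableEq α] [Fintype ι] [DecidableEq ι]

omit [DecidableEq α] in
/-- A two-term leg `q ↦ (a bᵀ + c dᵀ)_{q.1 q.2}`, read back as a matrix, has rank `≤ 2`.
[folklore] -/
theorem rank_leg_two_le (a b c d : α → ℂ) :
    (Matrix.of (Function.curry fun q : α × α => (vecMulVec a b + vecMulVec c d) q.1 q.2)).rank
      ≤ 2 :=
  rank_vecMulVec_add_vecMulVec_le a b c d

omit [DecidableEq α] in
/-- A one-term leg `q ↦ (a bᵀ)_{q.1 q.2}`, read back as a matrix, has rank `≤ 2`. [folklore] -/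
theorem rank_leg_one_le (a b : α → ℂ) :
    (Matrix.of (Function.curry fun q : α × α => vecMulVec a b q.1 q.2)).rank ≤ 2 :=
  (rank_vecMulVec_le a b).trans one_le_two

omit [DecidableEq α] in
/-- The linear form of a two-term leg `a bᵀ + c dᵀ` evaluated at `x`:
`∑_{i,j} a_i b_j x_{ij} + ∑_{i,j} c_i d_j x_{ij}`. [folklore] -/
theorem sum_leg_two_mul (a b c d : α → ℂ) (x : α × α → ℂ) :
    ∑ q, (vecMulVec a b + vecMulVec c d) q.1 q.2 * x q =
      (∑ i, ∑ j, a i * b j * x (i, j)) + ∑ i, ∑ j, c i * d j * x (i, j) := by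
  rw [Fintype.sum_prod_type]
  simp only [Matrix.add_apply, vecMulVec_apply, add_mul, Finset.sum_add_distrib]

omit [DecidableEq α] in
/-- The linear form of a one-term leg `a bᵀ` evaluated at `x`: `∑_{i,j} a_i b_j x_{ij}`.
[folklore] -/
theorem sum_leg_one_mul (a b : α → ℂ) (x : α × α → ℂ) :
    ∑ q, vecMulVec a b q.1 q.2 * x q = ∑ i, ∑ j, a i * b j * x (i, j) := by
  rw [Fintype.sum_prod_type]
  simp only [vecMulVec_apply]

/-- A single-entry probe `c₀ e_r e_qᵀ` evaluates to `c₀ x_{rq}`. [folklore] -/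
theorem sum_single_mul_single_mul (r q : α) (c₀ : ℂ) (x : α × α → ℂ) :
    ∑ i, ∑ j, (Pi.single r c₀ : α → ℂ) i * (Pi.single q (1 : ℂ) : α → ℂ) j * x (i, j) =
      c₀ * x (r, q) := by
  rw [Finset.sum_eq_single r (fun i _ hi => by simp [hi]) (by simp),
    Finset.sum_eq_single q (fun j _ hj => by simp [hj]) (by simp)]
  simp

/-- A row-segment probe `e_r 𝟙_{block B}ᵀ` evaluates to the row-segment sum
`∑_k x_{r,(B,k)}`. [folklore] -/
theorem sum_single_mul_block_mul (r : Fin 2 × ι) (B : Fin 2)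
    (x : (Fin 2 × ι) × (Fin 2 × ι) → ℂ) :
    ∑ i, ∑ j, (Pi.single r (1 : ℂ) : Fin 2 × ι → ℂ) i *
        ((Pi.single B (1 : ℂ) : Fin 2 → ℂ) ∘ Prod.fst) j * x (i, j) = ∑ k, x (r, (B, k)) := by
  rw [Finset.sum_eq_single r (fun i _ hi => by simp [hi]) (by simp), Fintype.sum_prod_type,
    Finset.sum_eq_single B (fun B' _ hB => by simp [hB]) (by simp)]
  simp

/-- A column-segment probe `𝟙_{block B} e_qᵀ` evaluates to the column-segment sum
`∑_k x_{(B,k),q}`. [folklore] -/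
theorem sum_block_mul_single_mul (B : Fin 2) (q : Fin 2 × ι)
    (x : (Fin 2 × ι) × (Fin 2 × ι) → ℂ) :
    ∑ i, ∑ j, ((Pi.single B (1 : ℂ) : Fin 2 → ℂ) ∘ Prod.fst) i *
        (Pi.single q (1 : ℂ) : Fin 2 × ι → ℂ) j * x (i, j) = ∑ k, x ((B, k), q) := by
  rw [Fintype.sum_prod_type, Finset.sum_eq_single B (fun B' _ hB => by simp [hB]) (by simp)]
  refine Finset.sum_congr rfl fun k _ => ?_
  rw [Finset.sum_eq_single q (fun j _ hj => by simp [hj]) (by simp)]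
  simp

end Legs

/-! ## Pan's two-fold aggregation identity -/

section PairIdentity

variable {ι : Type*} [Fintype ι]

/-- Moving the innermost of three summations outermost. [folklore] -/
theorem sum_sum_sum_comm_left (F : ι → ι → ι → ℂ) :
    ∑ j, ∑ k, ∑ i, F i j k = ∑ i, ∑ j, ∑ k, F i j k :=
  (Finset.sum_congr rfl fun _ _ => Finset.sum_comm).trans Finset.sum_comm

/-- Moving the outermost of three summations innermost. [folklore] -/
theorem sum_sum_sum_comm_right (F : ι → ι → ι → ℂ) :
    ∑ k, ∑ i, ∑ j, F i j k = ∑ i, ∑ j, ∑ k, F i j k :=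
  Finset.sum_comm.trans (Finset.sum_congr rfl fun _ _ => Finset.sum_comm)

/-- **Pan's two-fold aggregation identity** (Pan 1984, (4.1)–(4.3) with `m = n = p`): the `s³`
aggregates minus the three families of `s²` corrections equal the two trace forms
`∑ Z1 X1 Y1 + ∑ W U V` (the second written with its summation rotated). [folklore] -/
theorem pan_pair_identity (X1 U Y1 V Z1 W : ι → ι → ℂ) :
    (∑ i, ∑ j, ∑ k, (Z1 i k + W j i) * (X1 i j + U j k) * (Y1 j k + V k i))
    + ((∑ i, ∑ j, W j i * (-X1 i j) * ((∑ k, Y1 j k) + ∑ k, V k i))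
    + ((∑ j, ∑ k, ((∑ i, Z1 i k) + ∑ i, W j i) * (-U j k) * Y1 j k)
    + ∑ k, ∑ i, Z1 i k * ((∑ j, X1 i j) + ∑ j, U j k) * (-V k i)))
    = (∑ i, ∑ j, ∑ k, Z1 i k * X1 i j * Y1 j k) + ∑ a, ∑ b, ∑ c, W a c * U a b * V b c := by
  have hA : (∑ i, ∑ j, W j i * (-X1 i j) * ((∑ k, Y1 j k) + ∑ k, V k i)) =
      ∑ i, ∑ j, ∑ k, W j i * (-X1 i j) * (Y1 j k + V k i) := by
    refine Finset.sum_congr rfl fun i _ => Finset.sum_congr rfl fun j _ => ?_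
    rw [← Finset.sum_add_distrib, Finset.mul_sum]
  have hB : (∑ j, ∑ k, ((∑ i, Z1 i k) + ∑ i, W j i) * (-U j k) * Y1 j k) =
      ∑ i, ∑ j, ∑ k, (Z1 i k + W j i) * (-U j k) * Y1 j k := by
    refine Eq.trans ?_
      (sum_sum_sum_comm_left fun i j k => (Z1 i k + W j i) * (-U j k) * Y1 j k)
    refine Finset.sum_congr rfl fun j _ => Finset.sum_congr rfl fun k _ => ?_
    rw [← Finset.sum_add_distrib, Finset.sum_mul, Finset.sum_mul]
  have hC : (∑ k, ∑ i, Z1 i k * ((∑ j, X1 i j) + ∑ j, U j k) * (-V k i)) =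
      ∑ i, ∑ j, ∑ k, Z1 i k * (X1 i j + U j k) * (-V k i) := by
    refine Eq.trans ?_
      (sum_sum_sum_comm_right fun i j k => Z1 i k * (X1 i j + U j k) * (-V k i))
    refine Finset.sum_congr rfl fun k _ => Finset.sum_congr rfl fun i _ => ?_
    rw [← Finset.sum_add_distrib, Finset.mul_sum, Finset.sum_mul]
  have hR : (∑ a, ∑ b, ∑ c, W a c * U a b * V b c) =
      ∑ i, ∑ j, ∑ k, W j i * U j k * V k i :=
    (sum_sum_sum_comm_right fun a b c => W c b * U c a * V a b).trans
      (sum_sum_sum_comm_right fun i j k => W j i * U j k * V k i)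
  rw [hA, hB, hC, hR]
  simp only [← Finset.sum_add_distrib]
  refine Finset.sum_congr rfl fun i _ => Finset.sum_congr rfl fun j _ =>
    Finset.sum_congr rfl fun k _ => ?_
  ring

end PairIdentity

section Index

/-- Summation over the term index set `Fin 2 × Fin 2 × (ι³ ⊕ ι² ⊕ ι² ⊕ ι²)` (pair `(J,K)`;
aggregates; three correction families), unrolled. [folklore] -/
theorem sum_pan_index {ι : Type*} [Fintype ι]
    (f : Fin 2 × Fin 2 × ((ι × ι × ι) ⊕ (ι × ι) ⊕ (ι × ι) ⊕ (ι × ι)) → ℂ) :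
    ∑ l, f l = ∑ J, ∑ K, ((∑ i, ∑ j, ∑ k, f (J, K, Sum.inl (i, j, k)))
      + ((∑ i, ∑ j, f (J, K, Sum.inr (Sum.inl (i, j))))
      + ((∑ j, ∑ k, f (J, K, Sum.inr (Sum.inr (Sum.inl (j, k)))))
      + ∑ k, ∑ i, f (J, K, Sum.inr (Sum.inr (Sum.inr (k, i))))))) := by
  simp only [Fintype.sum_prod_type, Fintype.sum_sum_type]

/-- The term index set has `4 (s³ + 3 s²)` elements. [folklore] -/
theorem card_pan_index (s : ℕ) :
    Fintype.card (Fin 2 × Fin 2 ×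
      ((Fin s × Fin s × Fin s) ⊕ (Fin s × Fin s) ⊕ (Fin s × Fin s) ⊕ (Fin s × Fin s))) =
      4 * (s ^ 3 + 3 * s ^ 2) := by
  simp only [Fintype.card_prod, Fintype.card_sum, Fintype.card_fin]
  ring

end Index

end Summit.MatrixMultiplication.MatrixMultiplication.Theorems
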